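import Summits.ABC.IUTFork.Conditional.AbcOfSGenuineMChosenDepthRad
import Summits.ABC.IUTFork.Conditional.AbcOfSGenuineKChosenDepthRadTriple
import HarnessLib

/-!
# Branch C, M line / R-W lane P−: the EXACT-RADIUS («RAD») refutation at abc-TRIPLE data ON THE M LINE, CERTIFICATE-LIST form —
# the M twin of abc-iut-w5-d236's `AbcOfSGenuineKChosenDepthRadTriple` (p467119): one `decide` per row

PROOF-ONLY file (no `def`, no new `Prop`, no instance) of the abc-iut cell (D-0079 R-W numerics crew seat abc-iut-W-num-6, gen 2; row
«W:M-RAD-PORT», sequel of this seat's `AbcOfSGenuineMChosenDepthRad`). TAKES NO SIDE on [IUTchIII] Cor. 3.12 or on any author.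
* §1 `GenuineM.absRamificationIdx_kOfM_dvd_of_triple_thirty/_ten/_six/_two` — the local type `e(K_{v̲(x₀)}/ℚ_p) ∣ 30·l` (`∣ 10·l` if `3 ∣ v`,
  `∣ 6·l` if `5 ∣ v`, `∣ 2·l` if `15 ∣ v`) at EVERY member `x₀ ∈ V̲_u` over a pole prime `p = p_u ∉ {2,3,5,l}` of an abc-triple datum
  (`p^v ∥ abc`): the place-level Tate-exact lemmas of abc-iut-W-neg-1 / abc-iut-W-ref-2 (`ThetaVolumeDatumAt.ramificationIdx_int_dvd_…_mul_ratPoint'`)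
  read at the M-line place `placeOfM T.D u x₀` (`absRamificationIdx_rescaledCompletion`), with abc-iut-w5-d236's `RadTriple.ord_jInv_…` pole facts BY NAME;
* §2 `GenuineM.not_pilotKummerCompatHull_triple_of_radCerts` — M twin of `GenuineK.not_pilotKummerCompatHull_chosen_triple_of_radCerts`: `a + b = c`
  coprime, `T` a genuine Θ-volume datum at `(ratPoint (a/c), l)`, a finite place `u` of `ℚ` with `p_u = p ≠ 2, l`, `p^v ∥ abc` (`v ≥ 1`), a label
  `i₀+1 ≤ l⋆`, a local-type bound `m` (`p ∤ m`, `e(K_{v̲(x₀)}/ℚ_p) ∣ m` at every member — binder, §1 discharges it) and a list of certificates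
  `(e, A, a₀, N)` COVERING `Nat.divisors m` and VALID (window, turning point, the two RAD inequalities with `h = 2v`, `δ = e−1`) ⇒ the hull-level
  clause S_H FAILS at the summand-route M-level sharp setting of `T`'s OWN read-off ideles (pinned reading — the per-datum object of the M window
  binder of `abc_of_SH_v11M_window`) for every choice of the free context binders and Kummer datum. The prime enters as a NUMBER `p` with
  `hu : ratChar u = p`, so the rows' side conditions stay `norm_num`/`decide` exactly as on the K line.
The rows (the RAD part of the R-W numerics lead's HOME/plan/rescue/R-W/M-TWIN-GAP.tsv) are filed separately as `AbcOfSGenuineMChosenDepthRadRows*`.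
HONEST SCOPE (binding, as the parents): SHARP reading; per-label licence STRONGER than print; nothing about the printed GLOBAL inequality, the number-level
Corollary or any author's intended hull; admissibility / Szpiro-badness / (P6) / non-emptiness NOT claimed; «refuted as typed» ≠ «refuted in print»;
typed ≠ proved; instantiated ≠ endorsed; no abc claim. [cite: Mochizuki2012, IUTchIII Cor. 3.12 Step (xi-f) p. 184; IUTchIV Prop. 1.2 (i)(ii) p. 10,
Thm. 1.10 proof Steps (ii)–(iii) p. 24–26, Cor. 2.2 (ii) proof p. 44–46] [cite: Serre1972, §1.11–§1.12] [cite: NeukirchANT1999, Ch. II (5.5)]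
[claim: Mochizuki2012, status: disputed] for every IUT sentence quoted.
-/

noncomputable section

open Set Function NumberField IsDedekindDomain

namespace Summit.ABC.IUTFork.Conditional

open Thm311 Thm311.Real Cor312 Cor312Vol Cor312Prov Literature.IUT.LogThetaLattice Literature.IUT.LogVolume
  Literature.IUT.HodgeTheaters Literature.IUT.LogVolume.ThetaData Literature.IUT.LogVolume.Cor22
  Literature.NumberTheory.NumberFields
open Literature.NumberTheory.GaloisRepresentations.Ultrametric
open Literature.NumberTheory.DiophantineGeometry Literature.NumberTheory.DiophantineGeometry.GenEll Summit.ABC.ABC.Theorems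

/-! ## §1. The local type of an abc-triple datum at the M-line members over a pole prime -/

section LocalType

variable {a b c : ℕ} (habc : IsABCTriple a b c) {l : ℕ} (T : Cor22.ThetaVolumeDatumAt (ratPoint ((a : ℚ) / c)) l)
  (u : FinitePlace ℚ) (p : ℕ) (hu : ratChar u = p) (hp2 : p ≠ 2) (hp3 : p ≠ 3) (hp5 : p ≠ 5) (hpl : p ≠ l)
  {v : ℕ} (hv : 1 ≤ v) (hdvd : p ^ v ∣ a * b * c) (hndvd : ¬ p ^ (v + 1) ∣ a * b * c)

include habc hu hp2 hp3 hp5 hpl hv hdvd hndvd in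
/-- **Local type `∣ 30·l`** at every member `x₀ ∈ V̲_u` over a pole prime `p = p_u ∉ {2, 3, 5, l}` of an abc-triple datum, M line
(`ThetaVolumeDatumAt.ramificationIdx_int_dvd_thirty_mul_ratPoint'` at `placeOfM T.D u x₀`). [cite: Mochizuki2012, IUTchIV Thm. 1.10 proof Steps (ii)–(iii) p. 24–26]
[cite: Serre1972, §1.11–§1.12] [claim: Mochizuki2012, status: disputed] -/
theorem GenuineM.absRamificationIdx_kOfM_dvd_of_triple_thirty :
    letI := T.instFieldF; letI := T.instNumberFieldF; letI := T.instAlgebraF; letI := T.instFieldK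
    letI := T.instNumberFieldK; letI := T.instAlgebraK; letI := T.instFieldFbar; letI := T.instAlgebraFbar
    letI := T.instAlgebraKFbar; letI := T.instIsElliptic
    ∀ x₀ : (thetaIndexOfInitial T.D).Fibre (Val.non u),
      absRamificationIdx (ratChar u) (kOfM T.D (ratChar u) u (natCast_ratChar_mem u) x₀) ∣ 30 * l := by
  letI := T.instFieldF; letI := T.instNumberFieldF; letI := T.instAlgebraF; letI := T.instFieldK
  letI := T.instNumberFieldK; letI := T.instAlgebraK; letI := T.instFieldFbar; letI := T.instAlgebraFbar
  letI := T.instAlgebraKFbar; letI := T.instIsElliptic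
  intro x₀
  subst hu
  haveI hpfact : Fact (ratChar u).Prime := inferInstance
  have hp : (ratChar u).Prime := hpfact.out
  set w := placeOfM T.D u x₀ with hwdef
  have hpw : ((ratChar u : ℕ) : 𝓞 T.K) ∈ w.asIdeal := natCast_mem_placeOfM T.D (ratChar u) u (natCast_ratChar_mem u) x₀
  have hwchar : residueChar T.K w = ratChar u := residueChar_eq_of_natCast_mem (ratChar u) hpw
  have heK : absRamificationIdx (ratChar u) (kOfM T.D (ratChar u) u (natCast_ratChar_mem u) x₀) = w.asIdeal.ramificationIdx ℤ :=
    absRamificationIdx_rescaledCompletion T.K (ratChar u) w hpw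
  have hnot : ratChar u ∉ ({2, 3, 5, l} : Finset ℕ) := by
    simp only [Finset.mem_insert, Finset.mem_singleton, not_or]
    exact ⟨hp2, hp3, hp5, hpl⟩
  rw [heK]
  exact T.ramificationIdx_int_dvd_thirty_mul_ratPoint' hnot (RadTriple.ord_jInv_neg_of_pow_dvd habc hp hp2 hv hdvd hndvd) w hwchar

include habc hu hp2 hp3 hp5 hpl hv hdvd hndvd in
/-- **Local type `∣ 10·l` when `3 ∣ v`** at every member `x₀ ∈ V̲_u` over a pole prime `p = p_u ∉ {2, 3, 5, l}` of an abc-triple datum, M line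
(`ThetaVolumeDatumAt.ramificationIdx_int_dvd_ten_mul_ratPoint'` at `placeOfM T.D u x₀`). [cite: Mochizuki2012, IUTchIV Thm. 1.10 proof Steps (ii)–(iii) p. 24–26]
[cite: Serre1972, §1.11–§1.12] [claim: Mochizuki2012, status: disputed] -/
theorem GenuineM.absRamificationIdx_kOfM_dvd_of_triple_ten (h3 : 3 ∣ v) :
    letI := T.instFieldF; letI := T.instNumberFieldF; letI := T.instAlgebraF; letI := T.instFieldK
    letI := T.instNumberFieldK; letI := T.instAlgebraK; letI := T.instFieldFbar; letI := T.instAlgebraFbar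
    letI := T.instAlgebraKFbar; letI := T.instIsElliptic
    ∀ x₀ : (thetaIndexOfInitial T.D).Fibre (Val.non u),
      absRamificationIdx (ratChar u) (kOfM T.D (ratChar u) u (natCast_ratChar_mem u) x₀) ∣ 10 * l := by
  letI := T.instFieldF; letI := T.instNumberFieldF; letI := T.instAlgebraF; letI := T.instFieldK
  letI := T.instNumberFieldK; letI := T.instAlgebraK; letI := T.instFieldFbar; letI := T.instAlgebraFbar
  letI := T.instAlgebraKFbar; letI := T.instIsElliptic
  intro x₀
  subst hu
  haveI hpfact : Fact (ratChar u).Prime := inferInstance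
  have hp : (ratChar u).Prime := hpfact.out
  set w := placeOfM T.D u x₀ with hwdef
  have hpw : ((ratChar u : ℕ) : 𝓞 T.K) ∈ w.asIdeal := natCast_mem_placeOfM T.D (ratChar u) u (natCast_ratChar_mem u) x₀
  have hwchar : residueChar T.K w = ratChar u := residueChar_eq_of_natCast_mem (ratChar u) hpw
  have heK : absRamificationIdx (ratChar u) (kOfM T.D (ratChar u) u (natCast_ratChar_mem u) x₀) = w.asIdeal.ramificationIdx ℤ :=
    absRamificationIdx_rescaledCompletion T.K (ratChar u) w hpw
  have hnot : ratChar u ∉ ({2, 3, 5, l} : Finset ℕ) := by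
    simp only [Finset.mem_insert, Finset.mem_singleton, not_or]
    exact ⟨hp2, hp3, hp5, hpl⟩
  rw [heK]
  exact T.ramificationIdx_int_dvd_ten_mul_ratPoint' hnot (RadTriple.ord_jInv_neg_of_pow_dvd habc hp hp2 hv hdvd hndvd)
    (RadTriple.intCast_dvd_ord_jInv_of_dvd habc hp hp2 hv hdvd hndvd (dvd_mul_of_dvd_right h3 2)) w hwchar

include habc hu hp2 hp3 hp5 hpl hv hdvd hndvd in
/-- **Local type `∣ 6·l` when `5 ∣ v`** at every member `x₀ ∈ V̲_u` over a pole prime `p = p_u ∉ {2, 3, 5, l}` of an abc-triple datum, M line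
(`ThetaVolumeDatumAt.ramificationIdx_int_dvd_six_mul_ratPoint'` at `placeOfM T.D u x₀`). [cite: Mochizuki2012, IUTchIV Thm. 1.10 proof Steps (ii)–(iii) p. 24–26]
[cite: Serre1972, §1.11–§1.12] [claim: Mochizuki2012, status: disputed] -/
theorem GenuineM.absRamificationIdx_kOfM_dvd_of_triple_six (h5 : 5 ∣ v) :
    letI := T.instFieldF; letI := T.instNumberFieldF; letI := T.instAlgebraF; letI := T.instFieldK
    letI := T.instNumberFieldK; letI := T.instAlgebraK; letI := T.instFieldFbar; letI := T.instAlgebraFbar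
    letI := T.instAlgebraKFbar; letI := T.instIsElliptic
    ∀ x₀ : (thetaIndexOfInitial T.D).Fibre (Val.non u),
      absRamificationIdx (ratChar u) (kOfM T.D (ratChar u) u (natCast_ratChar_mem u) x₀) ∣ 6 * l := by
  letI := T.instFieldF; letI := T.instNumberFieldF; letI := T.instAlgebraF; letI := T.instFieldK
  letI := T.instNumberFieldK; letI := T.instAlgebraK; letI := T.instFieldFbar; letI := T.instAlgebraFbar
  letI := T.instAlgebraKFbar; letI := T.instIsElliptic
  intro x₀
  subst hu
  haveI hpfact : Fact (ratChar u).Prime := inferInstance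
  have hp : (ratChar u).Prime := hpfact.out
  set w := placeOfM T.D u x₀ with hwdef
  have hpw : ((ratChar u : ℕ) : 𝓞 T.K) ∈ w.asIdeal := natCast_mem_placeOfM T.D (ratChar u) u (natCast_ratChar_mem u) x₀
  have hwchar : residueChar T.K w = ratChar u := residueChar_eq_of_natCast_mem (ratChar u) hpw
  have heK : absRamificationIdx (ratChar u) (kOfM T.D (ratChar u) u (natCast_ratChar_mem u) x₀) = w.asIdeal.ramificationIdx ℤ :=
    absRamificationIdx_rescaledCompletion T.K (ratChar u) w hpw
  have hnot : ratChar u ∉ ({2, 3, 5, l} : Finset ℕ) := by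
    simp only [Finset.mem_insert, Finset.mem_singleton, not_or]
    exact ⟨hp2, hp3, hp5, hpl⟩
  rw [heK]
  exact T.ramificationIdx_int_dvd_six_mul_ratPoint' hnot (RadTriple.ord_jInv_neg_of_pow_dvd habc hp hp2 hv hdvd hndvd)
    (RadTriple.intCast_dvd_ord_jInv_of_dvd habc hp hp2 hv hdvd hndvd (dvd_mul_of_dvd_right h5 2)) w hwchar

include habc hu hp2 hp3 hp5 hpl hv hdvd hndvd in
/-- **Local type `∣ 2·l` when `15 ∣ v`** at every member `x₀ ∈ V̲_u` over a pole prime `p = p_u ∉ {2, 3, 5, l}` of an abc-triple datum, M line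
(`ThetaVolumeDatumAt.ramificationIdx_int_dvd_two_mul_ratPoint'` at `placeOfM T.D u x₀`). [cite: Mochizuki2012, IUTchIV Thm. 1.10 proof Steps (ii)–(iii) p. 24–26]
[cite: Serre1972, §1.11–§1.12] [claim: Mochizuki2012, status: disputed] -/
theorem GenuineM.absRamificationIdx_kOfM_dvd_of_triple_two (h15 : 15 ∣ v) :
    letI := T.instFieldF; letI := T.instNumberFieldF; letI := T.instAlgebraF; letI := T.instFieldK
    letI := T.instNumberFieldK; letI := T.instAlgebraK; letI := T.instFieldFbar; letI := T.instAlgebraFbar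
    letI := T.instAlgebraKFbar; letI := T.instIsElliptic
    ∀ x₀ : (thetaIndexOfInitial T.D).Fibre (Val.non u),
      absRamificationIdx (ratChar u) (kOfM T.D (ratChar u) u (natCast_ratChar_mem u) x₀) ∣ 2 * l := by
  letI := T.instFieldF; letI := T.instNumberFieldF; letI := T.instAlgebraF; letI := T.instFieldK
  letI := T.instNumberFieldK; letI := T.instAlgebraK; letI := T.instFieldFbar; letI := T.instAlgebraFbar
  letI := T.instAlgebraKFbar; letI := T.instIsElliptic
  intro x₀
  subst hu
  haveI hpfact : Fact (ratChar u).Prime := inferInstance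
  have hp : (ratChar u).Prime := hpfact.out
  set w := placeOfM T.D u x₀ with hwdef
  have hpw : ((ratChar u : ℕ) : 𝓞 T.K) ∈ w.asIdeal := natCast_mem_placeOfM T.D (ratChar u) u (natCast_ratChar_mem u) x₀
  have hwchar : residueChar T.K w = ratChar u := residueChar_eq_of_natCast_mem (ratChar u) hpw
  have heK : absRamificationIdx (ratChar u) (kOfM T.D (ratChar u) u (natCast_ratChar_mem u) x₀) = w.asIdeal.ramificationIdx ℤ :=
    absRamificationIdx_rescaledCompletion T.K (ratChar u) w hpw
  have hnot : ratChar u ∉ ({2, 3, 5, l} : Finset ℕ) := by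
    simp only [Finset.mem_insert, Finset.mem_singleton, not_or]
    exact ⟨hp2, hp3, hp5, hpl⟩
  rw [heK]
  exact T.ramificationIdx_int_dvd_two_mul_ratPoint' hnot (RadTriple.ord_jInv_neg_of_pow_dvd habc hp hp2 hv hdvd hndvd)
    (RadTriple.intCast_dvd_ord_jInv_of_dvd habc hp hp2 hv hdvd hndvd (dvd_mul_of_dvd_right h15 2)) w hwchar

end LocalType

/-! ## §2. The certificate-list refutation on the M line -/

/-- **RAD REFUTATION AT AN abc-TRIPLE DATUM, M LINE, CERTIFICATE-LIST FORM.** `a + b = c` coprime, `T` a genuine Θ-volume datum at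
`(ratPoint (a/c), l)`; a finite place `u` of `ℚ` with `p_u = p`, `p ≠ 2, l`, `p^v ∣ abc`, `p^{v+1} ∤ abc` (`v ≥ 1`; pole order `h = 2v`); a label
`j = i₀+1 ≤ l⋆`; a local-type bound `m` with `p ∤ m` and `e(K_{v̲(x₀)}/ℚ_p) ∣ m` at every member `x₀ ∈ V̲_u` (binder; §1 discharges it); a list
`certs` of quadruples `(e, A, a₀, N)` COVERING `Nat.divisors m` and VALID (window of `A`, turning point `a₀`, the two RAD inequalities with `h = 2v`,
`δ = e − 1`). THEN the hull-level clause S_H FAILS at the summand-route M-level sharp setting of `T`'s OWN read-off ideles (pinned reading) for every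
choice of the free context binders and Kummer datum — one `exact …_of_not_dvd` (this seat's M1 file) at the certificate of the local type of any member.
M-line twin of abc-iut-w5-d236's `GenuineK.not_pilotKummerCompatHull_chosen_triple_of_radCerts`. Sharp reading; refuted-as-typed only.
[cite: Mochizuki2012, IUTchIII Cor. 3.12 Step (xi-f) p. 184; IUTchIV Prop. 1.2 (i)(ii) p. 10] [cite: NeukirchANT1999, Ch. II (5.5)]
[claim: Mochizuki2012, status: disputed] -/
theorem GenuineM.not_pilotKummerCompatHull_triple_of_radCerts {a b c : ℕ} (habc : IsABCTriple a b c) {l : ℕ}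
    (T : Cor22.ThetaVolumeDatumAt (ratPoint ((a : ℚ) / c)) l) (u : FinitePlace ℚ) (p : ℕ) (hu : ratChar u = p)
    (hp2 : p ≠ 2) (hpl : p ≠ l)
    (v : ℕ) (hv : 1 ≤ v) (hdvd : p ^ v ∣ a * b * c) (hndvd : ¬ p ^ (v + 1) ∣ a * b * c)
    (i₀ : ℕ) (hil : i₀ + 1 ≤ (l - 1) / 2) (m : ℕ) (hpm : ¬ p ∣ m)
    (hloc : letI := T.instFieldF; letI := T.instNumberFieldF; letI := T.instAlgebraF; letI := T.instFieldK
      letI := T.instNumberFieldK; letI := T.instAlgebraK; letI := T.instFieldFbar; letI := T.instAlgebraFbar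
      letI := T.instAlgebraKFbar; letI := T.instIsElliptic
      ∀ x₀ : (thetaIndexOfInitial T.D).Fibre (Val.non u), absRamificationIdx (ratChar u) (kOfM T.D (ratChar u) u (natCast_ratChar_mem u) x₀) ∣ m)
    (certs : List (ℕ × ℕ × ℕ × ℤ))
    (hcover : ∀ e ∈ Nat.divisors m, ∃ t ∈ certs, t.1 = e)
    (hvalid : ∀ t ∈ certs, 1 ≤ t.1 ∧ (t.2.1 - 1) * (p - 2) < t.1 ∧ t.1 ≤ t.2.1 * (p - 2) ∧
      (t.2.2.1 = 0 ∨ (p : ℤ) ^ (t.2.2.1 - 1) * ((p : ℤ) - 1) < t.1) ∧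
      (t.1 : ℤ) ≤ (p : ℤ) ^ t.2.2.1 * ((p : ℤ) - 1) ∧
      2 * (l : ℤ) * t.1 * t.2.2.2 ≤
        ((i₀ : ℤ) + 1) ^ 2 * ((2 * v : ℕ) : ℤ) * t.1 - 2 * l * (((i₀ : ℤ) + 1) * ((t.1 : ℤ) - 1) + ((i₀ : ℤ) + 2) * t.2.1) ∧
      (((2 * v : ℕ) : ℤ)) * t.1 < 2 * l * ((t.1 : ℤ) * t.2.2.2 + ((i₀ : ℤ) + 2) * ((p : ℤ) ^ t.2.2.1 - t.1 * t.2.2.1))) :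
    letI := T.instFieldF; letI := T.instNumberFieldF; letI := T.instAlgebraF; letI := T.instFieldK
    letI := T.instNumberFieldK; letI := T.instAlgebraK; letI := T.instFieldFbar; letI := T.instAlgebraFbar
    letI := T.instAlgebraKFbar; letI := T.instIsElliptic
    ∀ (M : Type) [Field M] [NumberField M]
      (archPk : ∀ (j : (thetaIndexOfInitial T.D).Label) (vQ : (thetaIndexOfInitial T.D).VQ),
        Set ((logShellsOfInitialDH T.D (analyticLogvVal T.K)).Packet j vQ))
      (archSub : ∀ (j : (thetaIndexOfInitial T.D).Label) (v : (thetaIndexOfInitial T.D).V),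
        Set ((logShellsOfInitialDH T.D (analyticLogvVal T.K)).Packet j ((thetaIndexOfInitial T.D).over v)))
      (Ψ : ℤ → ∀ v : (thetaIndexOfInitial T.D).V, v ∈ (thetaIndexOfInitial T.D).Vbad →
        Set ((logShellsOfInitialDH T.D (analyticLogvVal T.K)).StarPacket v))
      (act : ℤ → ∀ v : (thetaIndexOfInitial T.D).V, v ∈ (thetaIndexOfInitial T.D).Vbad →
        (logShellsOfInitialDH T.D (analyticLogvVal T.K)).StarPacket v →
          Module.End ℚ ((logShellsOfInitialDH T.D (analyticLogvVal T.K)).StarPacket v))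
      (Mmod : ℤ → ∀ j : (thetaIndexOfInitial T.D).LabelStar, Set ((logShellsOfInitialDH T.D (analyticLogvVal T.K)).GlobalPacket j.1))
      (region : ℤ → ∀ j : (thetaIndexOfInitial T.D).LabelStar, FinDivisor M → ∀ vQ : (thetaIndexOfInitial T.D).VQ,
        Set ((logShellsOfInitialDH T.D (analyticLogvVal T.K)).Packet j.1 vQ))
      (frobAdm : ℤ → ℤ → ∀ (j : (thetaIndexOfInitial T.D).Label) (vQ : (thetaIndexOfInitial T.D).VQ),
        Set ((logShellsOfInitialDH T.D (analyticLogvVal T.K)).Packet j vQ) → Prop)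
      (frobLogvol : ℤ → ℤ → ∀ (j : (thetaIndexOfInitial T.D).Label) (vQ : (thetaIndexOfInitial T.D).VQ),
        Set ((logShellsOfInitialDH T.D (analyticLogvVal T.K)).Packet j vQ) → ℝ)
      (frobΨ : ℤ → ℤ → ∀ v : (thetaIndexOfInitial T.D).V, v ∈ (thetaIndexOfInitial T.D).Vbad →
        Set ((logShellsOfInitialDH T.D (analyticLogvVal T.K)).StarPacket v))
      (frobMmod : ℤ → ℤ → ∀ j : (thetaIndexOfInitial T.D).LabelStar, Set ((logShellsOfInitialDH T.D (analyticLogvVal T.K)).GlobalPacket j.1))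
      (unitImage : ℤ → ℤ → ℕ → ∀ (j : (thetaIndexOfInitial T.D).Label) (vQ : (thetaIndexOfInitial T.D).VQ),
        Set ((logShellsOfInitialDH T.D (analyticLogvVal T.K)).Packet j vQ))
      (ballImage : ℤ → ℤ → ∀ (j : (thetaIndexOfInitial T.D).Label) (vQ : (thetaIndexOfInitial T.D).VQ),
        Set ((logShellsOfInitialDH T.D (analyticLogvVal T.K)).Packet j vQ))
      (thetaDiv : ℤ → ℤ → LgpDivisor M (thetaIndexOfInitial T.D).lstar)
      (n : ℤ) {HT : Type} {LogLink : HT → HT → Type} {IsFull : ∀ {s t : HT}, LogLink s t → Prop}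
      (lat : LGPGaussianLogThetaLattice LogLink IsFull)
      {Frd : Type} {IsoF : Frd → Frd → Type} {Ob : Frd → Type} {realify : Frd → Frd} {Strip : Type}
      {IsoS : Strip → Strip → Type} {Mv : ∀ v : (thetaIndexOfInitial T.D).V, v ∈ (thetaIndexOfInitial T.D).Vbad → Type}
      [∀ v h, Monoid (Mv v h)]
      (sig : GlobalLGPFrobenioidSignature (thetaIndexOfInitial T.D).lstar (thetaIndexOfInitial T.D).V
        (· ∈ (thetaIndexOfInitial T.D).Vbad) Frd IsoF Ob realify Strip IsoS Mv)
      (split : SplittingMonoids Mv) {ObΔ : Type} {N : ∀ v : (thetaIndexOfInitial T.D).V, v ∈ (thetaIndexOfInitial T.D).Vbad → Type}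
      [∀ v h, Monoid (N v h)] (qData : QPilotData ObΔ N)
      (qK : ∀ v : (thetaIndexOfInitial T.D).V, v ∈ (thetaIndexOfInitial T.D).Vbad →
        Set ((logShellsOfInitialDH T.D (analyticLogvVal T.K)).StarPacket v)),
      ¬ Cor312Vol.PilotKummerCompatHull
        (LatticeSituation.ofShells (logShellsOfInitialDH T.D (analyticLogvVal T.K)) M archPk archSub
          (summandPiecesPrM T.D (logvAnalyticVal_analyticLogvVal (K := T.K))).Adm (summandPiecesPrM T.D (logvAnalyticVal_analyticLogvVal (K := T.K))).logvol Ψ act Mmod region frobAdm frobLogvol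
          frobΨ frobMmod unitImage ballImage thetaDiv)
        (settingPrVolSharpM T.D (logvAnalyticVal_analyticLogvVal (K := T.K)) (tOfIdeleData T.D (ideleDataOf T.D T.isVolumeInputOf))
          (fun u x => tqM T.D (ratChar u) u (natCast_ratChar_mem u) (ideleDataOf T.D T.isVolumeInputOf) x) M archPk archSub Ψ act Mmod region n lat sig split qData
          (fun u x => tqM_ne_zero T.D (ratChar u) u (natCast_ratChar_mem u) (ideleDataOf T.D T.isVolumeInputOf) x)
          (GenuineM.finite_ratPlaces_under_S T.D).toFinset
          (fun u x hu => norm_tqM_eq_one_of_not_mem T.D (ratChar u) u (natCast_ratChar_mem u) (ideleDataOf T.D T.isVolumeInputOf) x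
            fun hx => hu ((Set.Finite.mem_toFinset _).mpr ⟨x, hx⟩)))
        (fun _ => Cor312.Setting.qRegion
          (settingPrVolSharpM T.D (logvAnalyticVal_analyticLogvVal (K := T.K)) (tOfIdeleData T.D (ideleDataOf T.D T.isVolumeInputOf))
          (fun u x => tqM T.D (ratChar u) u (natCast_ratChar_mem u) (ideleDataOf T.D T.isVolumeInputOf) x) M archPk archSub Ψ act Mmod region n lat sig split qData
          (fun u x => tqM_ne_zero T.D (ratChar u) u (natCast_ratChar_mem u) (ideleDataOf T.D T.isVolumeInputOf) x)
          (GenuineM.finite_ratPlaces_under_S T.D).toFinset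
          (fun u x hu => norm_tqM_eq_one_of_not_mem T.D (ratChar u) u (natCast_ratChar_mem u) (ideleDataOf T.D T.isVolumeInputOf) x
            fun hx => hu ((Set.Finite.mem_toFinset _).mpr ⟨x, hx⟩)))) qK := by
  classical
  letI := T.instFieldF; letI := T.instNumberFieldF; letI := T.instAlgebraF; letI := T.instFieldK
  letI := T.instNumberFieldK; letI := T.instAlgebraK; letI := T.instFieldFbar; letI := T.instAlgebraFbar
  letI := T.instAlgebraKFbar; letI := T.instIsElliptic
  subst hu
  haveI hpfact : Fact (ratChar u).Prime := inferInstance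
  intro M _ _ archPk archSub Ψ act Mmod region frobAdm frobLogvol frobΨ frobMmod unitImage ballImage thetaDiv n HT LogLink IsFull lat
    Frd IsoF Ob realify Strip IsoS Mv _ sig split ObΔ N _ qData qK
  -- a member over `u`, its local type `e₀ ∣ m`, and the certificate of `e₀`
  obtain ⟨x, hx⟩ := (thetaIndexOfInitial T.D).fibre_nonempty (Val.non u)
  have hm0 : m ≠ 0 := by rintro rfl; exact hpm (dvd_zero _)
  obtain ⟨t, ht, hte⟩ := hcover _ (Nat.mem_divisors.2 ⟨hloc ⟨x, hx⟩, hm0⟩)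
  obtain ⟨he, hAlo, hAhi, ha₀lo, ha₀hi, hN1, hN2⟩ := hvalid t ht
  have hpe : ¬ ratChar u ∣ t.1 := fun h => hpm (h.trans (hte ▸ hloc ⟨x, hx⟩))
  have hord : ∀ u' : HeightOneSpectrum (𝓞 ℚ), Rat.HeightOneSpectrum.natGenerator u' = ratChar u →
      Literature.IUT.LogVolume.ord ℚ u' (Cor22.jInv ((a : ℚ) / c)) = -((2 * v : ℕ) : ℤ) :=
    fun u' hu' => RadTriple.ord_jInv_eq_of_pow_dvd habc hpfact.out hp2 hv hdvd hndvd u' hu'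
  exact GenuineM.not_pilotKummerCompatHull_ratPoint_of_star_envelope_of_not_dvd T u hp2 hpl (2 * v) (by omega) hord i₀ hil
    t.1 t.2.1 t.2.2.1 t.2.2.2 he hpe hAlo hAhi ha₀lo ha₀hi hN1 hN2 ⟨x, hx⟩ hte.symm M archPk archSub Ψ act Mmod region frobAdm
    frobLogvol frobΨ frobMmod unitImage ballImage thetaDiv n lat sig split qData qK

end Summit.ABC.IUTFork.Conditional

end
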